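import Mathlib
import Literature.RepresentationTheory.FiniteGroups.KLRGradedCellularBasis
import Summits.MatrixMultiplication.MatrixMultiplication.Theorems.SnSubsetDichotomyNoThresholdSubsetTripleSmallWeightTail
import Summits.MatrixMultiplication.MatrixMultiplication.Theorems.SnSubsetDichotomyNoThresholdSubsetTripleFirstRowTail
import Summits.MatrixMultiplication.MatrixMultiplication.Theorems.SnSubsetDichotomyNoThresholdSubsetTripleOfKlrMoments

/-!
# `SnSubsetDichotomy.NoThresholdSubsetTriple`, line `klr-graded-polynomial-method`:
# stubs `pairDeviation_of_shapeSplit` and `noThresholdSubsetTriple_of_klr_shapeSplit`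
# (the conditioning split: deviation count from a per-tableau and a per-shape count)

Index set: `i = (μ, S, T) : TableauPair n`, the same-shape pairs of standard tableaux with `n`
cells (`S = i.2.1`, `T = i.2.2`). Write `X i = TableauPair.degree 2 i = deg₂ S + deg₂ T`,
`w i = c₀ − (c₀ − c₁)²` with `cⱼ = TableauPair.content 2 i j` (the `2`-block weight, a function
of the shape `μ` only), `f = f^μ = #Std(μ)` and `Σ = ∑_{T' ∈ Std(μ)} deg₂ T'` (so `Σ / f` is the
mean degree of a tableau of shape `μ`).

The DEVIATION form `#{i : n ≤ 100·|X i − w i|} ≤ n!·e^{-c√n}` closes the crux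
(`noThresholdSubsetTriple_of_klr_pairDeviation`). This file derives it from two counts restricted
to the GOOD shapes `G = {μ₁ < 3√n, ℓ(μ) < 3√n, n ≤ 32w}`:

* (U) the per-TABLEAU count `#{G ∧ f·n ≤ 300·|f·deg₂ T − Σ|} ≤ n!·e^{-c√n}` (the degree of one
  tableau is `n/300`-close to its shape mean), and
* (D) the per-SHAPE count `#{G ∧ f·n ≤ 300·|2Σ − f·w|} ≤ n!·e^{-c√n}` (twice the shape mean is
  `n/300`-close to the weight).

Proof. Pointwise, `f·(X − w) = (f·deg₂ S − Σ) + (f·deg₂ T − Σ) + (2Σ − f·w)`, so if all three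
summands are `< f·n/300` in absolute value then `100·|X − w| < n`. Hence the deviation event lies
in `{μ₁ ≥ 3√n} ∪ {ℓ(μ) ≥ 3√n} ∪ {32w < n} ∪ U_S ∪ U_T ∪ D`, where `U_S` is the (U)-event for the
first tableau; `#U_S = #U_T` by the swap `(μ, S, T) ↦ (μ, T, S)`, `#{ℓ(μ) ≥ 3√n} ≤ #{μ₁ ≥ 3√n}`
by transposition (`KlrLine.card_colTail_le`), and the remaining counts are `firstRowTail`,
`smallWeightTail`, (U) and (D): in total `≤ 6·n!e^{-c√n} ≤ n!e^{-(c/2)√n}` for `c` the least of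
the four constants and `9 ≤ e^{(c/2)√n}` (`KlrLine.exists_three_le_exp`).
-/

namespace Summit.MatrixMultiplication.MatrixMultiplication.Theorems

open Literature.RepresentationTheory.FiniteGroups (TableauPair KLRGradedCellularBasis residueContent tableauDegree)
open Literature.NumberTheory.DiophantineGeometry (StdFilling)

namespace KlrLine

/-- Counting pattern: if every `P`-element is an `R`-, `C`-, `W`-, `S`-, `T`- or `D`-element,
`#C ≤ #R` and `#S ≤ #T`, then `#P ≤ 2·#R + #W + 2·#T + #D`. [folklore] -/
private theorem natCard_le_of_cases₆ {α : Type*} [Finite α] {P R C W S T D : α → Prop}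
    (hCR : Nat.card {i // C i} ≤ Nat.card {i // R i})
    (hST : Nat.card {i // S i} ≤ Nat.card {i // T i})
    (h : ∀ i, P i → R i ∨ C i ∨ W i ∨ S i ∨ T i ∨ D i) :
    Nat.card {i // P i} ≤
      2 * Nat.card {i // R i} + Nat.card {i // W i} + 2 * Nat.card {i // T i} +
        Nat.card {i // D i} := by
  classical
  haveI := Fintype.ofFinite α
  simp only [Nat.card_eq_fintype_card] at hCR hST ⊢
  have h0 := Fintype.card_subtype_mono _ _ h
  have h1 := Fintype.card_subtype_or R (fun i => C i ∨ W i ∨ S i ∨ T i ∨ D i)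
  have h2 := Fintype.card_subtype_or C (fun i => W i ∨ S i ∨ T i ∨ D i)
  have h3 := Fintype.card_subtype_or W (fun i => S i ∨ T i ∨ D i)
  have h4 := Fintype.card_subtype_or S (fun i => T i ∨ D i)
  have h5 := Fintype.card_subtype_or T D
  omega

/-- The pointwise step (integers): with `f > 0` and `X = X_S + X_T`,
`f·(X − w) = (f·X_S − Σ) + (f·X_T − Σ) + (2Σ − f·w)`; if the three summands are `< f·m/300` in
absolute value then `100·|X − w| < m`. [folklore] -/
private theorem hundred_mul_abs_lt {X XS XT w σ f m : ℤ} (hf : 0 < f) (hX : X = XS + XT)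
    (hS : 300 * |f * XS - σ| < f * m) (hT : 300 * |f * XT - σ| < f * m)
    (hD : 300 * |2 * σ - f * w| < f * m) : 100 * |X - w| < m := by
  have key : f * (X - w) = (f * XS - σ) + (f * XT - σ) + (2 * σ - f * w) := by
    rw [hX]
    ring
  by_contra h
  have h1 : f * m ≤ 100 * |(f * XS - σ) + (f * XT - σ) + (2 * σ - f * w)| :=
    calc f * m ≤ f * (100 * |X - w|) := mul_le_mul_of_nonneg_left (not_lt.1 h) hf.le
      _ = 100 * |f * (X - w)| := by
          rw [abs_mul, abs_of_pos hf]
          ring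
      _ = 100 * |(f * XS - σ) + (f * XT - σ) + (2 * σ - f * w)| := by rw [key]
  linarith [abs_add_three (f * XS - σ) (f * XT - σ) (2 * σ - f * w)]

/-- **The counting step of the conditioning split** on a finite index type, for integer-valued
`X = X_S + X_T` (pair degree), `w` (weight), `Σ` (shape sum), `f > 0` (shape size) and a
threshold `m`, with `A, B` the "boxed" conditions and `R, C` covering their complements:
`#{m ≤ 100|X − w|} ≤ 2·#R + #{32w < m} + 2·#U_T + #D`, given `#C ≤ #R` and `#U_S ≤ #U_T`
(`U_• = {G ∧ f·m ≤ 300|f·X_• − Σ|}`, `D = {G ∧ f·m ≤ 300|2Σ − f·w|}`, `G = A ∧ B ∧ m ≤ 32w`).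
[folklore] -/
private theorem card_dev_le {α : Type*} [Finite α] (X XS XT w σ f : α → ℤ) (m : ℤ)
    (A B R C : α → Prop) (hX : ∀ i, X i = XS i + XT i) (hf : ∀ i, 0 < f i)
    (hA : ∀ i, A i ∨ R i) (hB : ∀ i, B i ∨ C i)
    (hCR : Nat.card {i // C i} ≤ Nat.card {i // R i})
    (hST : Nat.card {i // (A i ∧ B i ∧ m ≤ 32 * w i) ∧ f i * m ≤ 300 * |f i * XS i - σ i|} ≤
      Nat.card {i // (A i ∧ B i ∧ m ≤ 32 * w i) ∧ f i * m ≤ 300 * |f i * XT i - σ i|}) :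
    Nat.card {i // m ≤ 100 * |X i - w i|} ≤
      2 * Nat.card {i // R i} + Nat.card {i // 32 * w i < m} +
        2 * Nat.card {i // (A i ∧ B i ∧ m ≤ 32 * w i) ∧ f i * m ≤ 300 * |f i * XT i - σ i|} +
        Nat.card {i // (A i ∧ B i ∧ m ≤ 32 * w i) ∧ f i * m ≤ 300 * |2 * σ i - f i * w i|} := by
  refine natCard_le_of_cases₆ hCR hST fun i hi => ?_
  rcases hA i with hAi | hRi
  · rcases hB i with hBi | hCi
    · by_cases hw : 32 * w i < m
      · exact Or.inr (Or.inr (Or.inl hw))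
      have hG : A i ∧ B i ∧ m ≤ 32 * w i := ⟨hAi, hBi, not_lt.1 hw⟩
      by_cases hS : f i * m ≤ 300 * |f i * XS i - σ i|
      · exact Or.inr (Or.inr (Or.inr (Or.inl ⟨hG, hS⟩)))
      by_cases hT : f i * m ≤ 300 * |f i * XT i - σ i|
      · exact Or.inr (Or.inr (Or.inr (Or.inr (Or.inl ⟨hG, hT⟩))))
      by_cases hD : f i * m ≤ 300 * |2 * σ i - f i * w i|
      · exact Or.inr (Or.inr (Or.inr (Or.inr (Or.inr ⟨hG, hD⟩))))
      exact absurd (hundred_mul_abs_lt (hf i) (hX i) (not_le.1 hS) (not_le.1 hT) (not_le.1 hD))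
        (not_lt.2 hi)
    · exact Or.inr (Or.inl hCi)
  · exact Or.inl hRi

/-- Constants: `6·n!e^{-c√n} ≤ n!e^{-(c/2)√n}` once `3 ≤ e^{(c/4)√n}` (`6 ≤ 9 ≤ e^{(c/2)√n}`).
[folklore] -/
private theorem six_mul_le_of_three_le_exp {c : ℝ} {n : ℕ}
    (h3 : (3 : ℝ) ≤ Real.exp (c / 2 / 2 * Real.sqrt (n : ℝ))) :
    6 * ((n.factorial : ℝ) * Real.exp (-(c * Real.sqrt (n : ℝ)))) ≤
      (n.factorial : ℝ) * Real.exp (-(c / 2 * Real.sqrt (n : ℝ))) := by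
  have h6 : (6 : ℝ) ≤ Real.exp (c / 2 * Real.sqrt (n : ℝ)) := by
    have h9 : (3 : ℝ) * 3 ≤ Real.exp (c / 2 / 2 * Real.sqrt (n : ℝ)) *
        Real.exp (c / 2 / 2 * Real.sqrt (n : ℝ)) :=
      mul_le_mul h3 h3 (by norm_num) (Real.exp_pos _).le
    rw [← Real.exp_add] at h9
    have : c / 2 / 2 * Real.sqrt (n : ℝ) + c / 2 / 2 * Real.sqrt (n : ℝ) =
        c / 2 * Real.sqrt (n : ℝ) := by ring
    rw [this] at h9
    linarith
  calc 6 * ((n.factorial : ℝ) * Real.exp (-(c * Real.sqrt (n : ℝ))))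
      ≤ Real.exp (c / 2 * Real.sqrt (n : ℝ)) *
          ((n.factorial : ℝ) * Real.exp (-(c * Real.sqrt (n : ℝ)))) := by gcongr
    _ = (n.factorial : ℝ) * Real.exp (-(c / 2 * Real.sqrt (n : ℝ))) := by
        rw [mul_left_comm, ← Real.exp_add]
        congr 1
        ring_nf

/-- Constants: `n!e^{-c'√n} ≤ n!e^{-c√n}` for `c ≤ c'`. [folklore] -/
private theorem factorial_mul_exp_anti {c c' : ℝ} (n : ℕ) (h : c ≤ c') :
    (n.factorial : ℝ) * Real.exp (-(c' * Real.sqrt (n : ℝ))) ≤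
      (n.factorial : ℝ) * Real.exp (-(c * Real.sqrt (n : ℝ))) := by
  gcongr

end KlrLine

set_option linter.dupNamespace false in -- deliberate Summit.<S>.<P> duplicate
open KlrLine in
/-- **Stub `pairDeviation_of_shapeSplit` (line `klr-graded-polynomial-method`, crux
`SnSubsetDichotomy.NoThresholdSubsetTriple`, stmt-MatrixMultiplication-8302): the conditioning
split.** With `X = deg₂ S + deg₂ T`, `w = c₀ − (c₀ − c₁)²` the `2`-weight, `f = #Std(μ)`,
`Σ = ∑_{T'} deg₂ T'` and the good shapes `G = {μ₁ < 3√n, ℓ(μ) < 3√n, n ≤ 32w}`: if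
`#{G ∧ f·n ≤ 300|f·deg₂ T − Σ|} ≤ n!e^{-c√n}` (U) and `#{G ∧ f·n ≤ 300|2Σ − f·w|} ≤ n!e^{-c√n}`
(D) for large `n`, then `#{n ≤ 100|X − w|} ≤ n!e^{-c'√n}` for large `n`. Proof: pointwise
`f(X − w) = (f·deg₂ S − Σ) + (f·deg₂ T − Σ) + (2Σ − f·w)` (`card_dev_le`), the swap
`(μ, S, T) ↦ (μ, T, S)` for the first tableau, `card_colTail_le`, `firstRowTail`,
`smallWeightTail`, and `6·n!e^{-c√n} ≤ n!e^{-(c/2)√n}`. [folklore] -/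
theorem pairDeviation_of_shapeSplit : (∃ c : ℝ, 0 < c ∧ ∃ n₀ : ℕ, ∀ n ≥ n₀, (Nat.card {i : TableauPair n // ((i.1.youngDiagram.rowLen 0 : ℝ) < 3 * Real.sqrt (n : ℝ) ∧ (i.1.youngDiagram.colLen 0 : ℝ) < 3 * Real.sqrt (n : ℝ) ∧ (n : ℤ) ≤ 32 * ((TableauPair.content 2 i 0 : ℤ) - ((TableauPair.content 2 i 0 : ℤ) - (TableauPair.content 2 i 1 : ℤ)) ^ 2)) ∧ (Fintype.card (StdFilling n i.1.youngDiagram) : ℤ) * (n : ℤ) ≤ 300 * |(Fintype.card (StdFilling n i.1.youngDiagram) : ℤ) * tableauDegree 2 i.2.2.1 - ∑ T : StdFilling n i.1.youngDiagram, tableauDegree 2 T.1|} : ℝ) ≤ (n.factorial : ℝ) * Real.exp (-(c * Real.sqrt (n : ℝ)))) → (∃ c : ℝ, 0 < c ∧ ∃ n₀ : ℕ, ∀ n ≥ n₀, (Nat.card {i : TableauPair n // ((i.1.youngDiagram.rowLen 0 : ℝ) < 3 * Real.sqrt (n : ℝ) ∧ (i.1.youngDiagram.colLen 0 : ℝ)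 < 3 * Real.sqrt (n : ℝ) ∧ (n : ℤ) ≤ 32 * ((TableauPair.content 2 i 0 : ℤ) - ((TableauPair.content 2 i 0 : ℤ) - (TableauPair.content 2 i 1 : ℤ)) ^ 2)) ∧ (Fintype.card (StdFilling n i.1.youngDiagram) : ℤ) * (n : ℤ) ≤ 300 * |2 * (∑ T : StdFilling n i.1.youngDiagram, tableauDegree 2 T.1) - (Fintype.card (StdFilling n i.1.youngDiagram) : ℤ) * ((TableauPair.content 2 i 0 : ℤ) - ((TableauPair.content 2 i 0 : ℤ) - (TableauPair.content 2 i 1 : ℤ)) ^ 2)|} : ℝ) ≤ (n.factorial : ℝ) * Real.exp (-(c * Real.sqrt (n : ℝ)))) → (∃ c : ℝ, 0 < c ∧ ∃ n₀ : ℕ, ∀ n ≥ n₀, (Nat.card {i : TableauPair n // (n : ℤ) ≤ 100 * |TableauPair.degree 2 i - ((TableauPair.content 2 i 0 : ℤ) - ((TableauPair.content 2 i 0 : ℤ) - (TableauPair.content 2 i 1 : ℤ)) ^ 2)|} : ℝ) ≤ (n.factorial : ℝ) * Real.exp (-(c * Real.sqrt (n : ℝ)))) := by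
  rintro ⟨c₁, hc₁, n₁, hU⟩ ⟨c₂, hc₂, n₂, hD⟩
  obtain ⟨c₃, hc₃, n₃, hR⟩ := firstRowTail
  obtain ⟨c₄, hc₄, n₄, hW⟩ := smallWeightTail
  obtain ⟨c, hc, hcle₁, hcle₂, hcle₃, hcle₄⟩ :
      ∃ c : ℝ, 0 < c ∧ c ≤ c₁ ∧ c ≤ c₂ ∧ c ≤ c₃ ∧ c ≤ c₄ :=
    ⟨min (min c₁ c₂) (min c₃ c₄), lt_min (lt_min hc₁ hc₂) (lt_min hc₃ hc₄),
      (min_le_left _ _).trans (min_le_left _ _), (min_le_left _ _).trans (min_le_right _ _),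
      (min_le_right _ _).trans (min_le_left _ _), (min_le_right _ _).trans (min_le_right _ _)⟩
  obtain ⟨n₅, hn₅⟩ := exists_three_le_exp (half_pos hc)
  refine ⟨c / 2, half_pos hc, max (max (max n₁ n₂) (max n₃ n₄)) n₅, fun n hn => ?_⟩
  obtain ⟨⟨⟨hn₁, hn₂⟩, hn₃, hn₄⟩, hn₅'⟩ :
      ((n₁ ≤ n ∧ n₂ ≤ n) ∧ n₃ ≤ n ∧ n₄ ≤ n) ∧ n₅ ≤ n := by
    simpa only [ge_iff_le, max_le_iff] using hn
  -- the counting step, in `ℕ`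
  have hcount := card_dev_le
    (fun i : TableauPair n => TableauPair.degree 2 i)
    (fun i : TableauPair n => tableauDegree 2 i.2.1.1)
    (fun i : TableauPair n => tableauDegree 2 i.2.2.1)
    (fun i : TableauPair n => (TableauPair.content 2 i 0 : ℤ) -
      ((TableauPair.content 2 i 0 : ℤ) - (TableauPair.content 2 i 1 : ℤ)) ^ 2)
    (fun i : TableauPair n => ∑ T : StdFilling n i.1.youngDiagram, tableauDegree 2 T.1)
    (fun i : TableauPair n => (Fintype.card (StdFilling n i.1.youngDiagram) : ℤ)) (n : ℤ)
    (fun i : TableauPair n => (i.1.youngDiagram.rowLen 0 : ℝ) < 3 * Real.sqrt (n : ℝ))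
    (fun i : TableauPair n => (i.1.youngDiagram.colLen 0 : ℝ) < 3 * Real.sqrt (n : ℝ))
    (fun i : TableauPair n => 3 * Real.sqrt (n : ℝ) ≤ (i.1.youngDiagram.rowLen 0 : ℝ))
    (fun i : TableauPair n => 3 * Real.sqrt (n : ℝ) ≤ (i.1.youngDiagram.colLen 0 : ℝ))
    (fun _ => rfl) (fun i => Int.natCast_pos.2 (Fintype.card_pos_iff.2 ⟨i.2.2⟩))
    (fun _ => lt_or_ge _ _) (fun _ => lt_or_ge _ _) (card_colTail_le n)
    (le_of_eq (Nat.card_congr (Equiv.subtypeEquiv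
      (Equiv.sigmaCongrRight fun _ => Equiv.prodComm _ _) fun _ => Iff.rfl)))
  have hRc := Nat.cast_le (α := ℝ) |>.2 hcount
  simp only [Nat.cast_add, Nat.cast_mul, Nat.cast_ofNat] at hRc
  refine hRc.trans ?_
  -- constants: `6·n!e^{-c√n} ≤ n!e^{-(c/2)√n}`
  have h6 := six_mul_le_of_three_le_exp (hn₅ n hn₅')
  have hUn := (hU n hn₁).trans (factorial_mul_exp_anti n hcle₁)
  have hDn := (hD n hn₂).trans (factorial_mul_exp_anti n hcle₂)
  have hRn := (hR n hn₃).trans (factorial_mul_exp_anti n hcle₃)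
  have hWn := (hW n hn₄).trans (factorial_mul_exp_anti n hcle₄)
  linarith [hUn, hDn, hRn, hWn, h6]

set_option linter.dupNamespace false in -- deliberate Summit.<S>.<P> duplicate
/-- **K3 ∧ (U) ∧ (D) ⟹ crux.** If `𝔽_p[S_n]` has the Hu–Mathas graded block basis
(`KLRGradedCellularBasis`) and, on the good shapes `G = {μ₁ < 3√n, ℓ(μ) < 3√n, n ≤ 32w}`, both
the per-tableau count `#{G ∧ f·n ≤ 300|f·deg₂ T − Σ|}` (U) and the per-shape count
`#{G ∧ f·n ≤ 300|2Σ − f·w|}` (D) are `≤ n!e^{-c√n}` for large `n`, then `NoThresholdSubsetTriple`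
holds. Composition of `pairDeviation_of_shapeSplit` with
`noThresholdSubsetTriple_of_klr_pairDeviation`. [folklore] -/
theorem noThresholdSubsetTriple_of_klr_shapeSplit : KLRGradedCellularBasis → (∃ c : ℝ, 0 < c ∧ ∃ n₀ : ℕ, ∀ n ≥ n₀, (Nat.card {i : TableauPair n // ((i.1.youngDiagram.rowLen 0 : ℝ) < 3 * Real.sqrt (n : ℝ) ∧ (i.1.youngDiagram.colLen 0 : ℝ) < 3 * Real.sqrt (n : ℝ) ∧ (n : ℤ) ≤ 32 * ((TableauPair.content 2 i 0 : ℤ) - ((TableauPair.content 2 i 0 : ℤ) - (TableauPair.content 2 i 1 : ℤ)) ^ 2)) ∧ (Fintype.card (StdFilling n i.1.youngDiagram) : ℤ) * (n : ℤ) ≤ 300 * |(Fintype.card (StdFilling n i.1.youngDiagram) : ℤ) * tableauDegree 2 i.2.2.1 - ∑ T : StdFilling n i.1.youngDiagram, tableauDegree 2 T.1|} : ℝ) ≤ (n.factorial : ℝ) * Real.exp (-(c * Real.sqrt (n : ℝ)))) → (∃ c : ℝ, 0 < c ∧ ∃ n₀ : ℕ, ∀ n ≥ n₀, (Nat.card {i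 : TableauPair n // ((i.1.youngDiagram.rowLen 0 : ℝ) < 3 * Real.sqrt (n : ℝ) ∧ (i.1.youngDiagram.colLen 0 : ℝ) < 3 * Real.sqrt (n : ℝ) ∧ (n : ℤ) ≤ 32 * ((TableauPair.content 2 i 0 : ℤ) - ((TableauPair.content 2 i 0 : ℤ) - (TableauPair.content 2 i 1 : ℤ)) ^ 2)) ∧ (Fintype.card (StdFilling n i.1.youngDiagram) : ℤ) * (n : ℤ) ≤ 300 * |2 * (∑ T : StdFilling n i.1.youngDiagram, tableauDegree 2 T.1) - (Fintype.card (StdFilling n i.1.youngDiagram) : ℤ) * ((TableauPair.content 2 i 0 : ℤ) - ((TableauPair.content 2 i 0 : ℤ) - (TableauPair.content 2 i 1 : ℤ)) ^ 2)|} : ℝ) ≤ (n.factorial : ℝ) * Real.exp (-(c * Real.sqrt (n : ℝ)))) → Summit.MatrixMultiplication.MatrixMultiplication.Theses.SnSubsetDichotomy.NoThresholdSubsetTriple :=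
  fun hK hU hD => noThresholdSubsetTriple_of_klr_pairDeviation hK (pairDeviation_of_shapeSplit hU hD)

end Summit.MatrixMultiplication.MatrixMultiplication.Theorems
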